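import Mathlib
import Literature.NumberTheory.EllipticCurves.HeegnerPoints
import Literature.NumberTheory.EllipticCurves.QuadraticTwist
import Literature.NumberTheory.EllipticCurves.BSDSelmerCMPConverseGoldfeldProofs
import Literature.NumberTheory.EllipticCurves.TwoIsogenySelmerGroup
import Literature.NumberTheory.EllipticCurves.MordellWeil

/-!
# Transfer lens g24 (seat bsd-idea-18) — the (J0-S8-CT) crux idea, typed

Crux `HeegnerTwistCouplingInSupply` (stmt-BirchSwinnertonDyer-21381), `j = 0` / X12 corner, EC half
**J0S8** (director-bsd (279)(c), 2026-08-28T20:24:25Z): «X12 pair ∧ `16 ∤ h(−3pℓ)` ⟹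
`selmerCorank₂((36a1)^{(pℓ)}) = 0`».  This file types the DECOMPOSITION of `J0S8` found in g24:

* `FirstDescentX12` — the first `2`-isogeny descent for `E_{pℓ} : y² = x³ + (pℓ)³ ≅ E_{a,b}`,
  `(a,b) = (−3pℓ, 3p²ℓ²)`: `S^{(φ)}(E/ℚ) = {1,−3,−p,3p,−ℓ,3ℓ,pℓ,−3pℓ}` (dim 3) and
  `S^{(φ̂)}(E'/ℚ) = {1,3}` (dim 1), in the tree's currency `twoIsogenySelmerGroup` (AEC X.4.9);
* `RedeiMinus p ℓ` — the elementary quadratic symbol `s_p(ℓ) := ((3x + y√(3p))/𝔩) = −1`, where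
  `3x² = py² + z²` is any primitive solution with `x > 0`, `𝔩 ∣ ℓ` a split prime of `ℚ(√3p)` not
  dividing `z` (a Rédei symbol `[3p, 3, −ℓ]`); `RedeiWellDefined` — its independence of the choices;
* `J0S8Sym` — the EC half with the SYMBOL hypothesis: X12 ∧ `s_p(ℓ) = −1` ⟹ `selmerCorank₂ = 0`
  (mechanism: the Cassels–Tate pairing `Θ₁` on `S^{(φ)}(E/ℚ)` has `Θ₁(−p,−ℓ) = s_p(ℓ)`, so `s_p(ℓ) = −1`
  forces `ker Θ₁ = ⟨−3⟩ = E'(ℚ)/φE(ℚ)`, `rank E(ℚ) = 0`, `Ш(E')[2^∞] = 0`, `Ш(E)[2^∞] = Ш(E)[φ] ≅ (ℤ/2)²`);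
* `R8Law` — Rédei–Reichardt: for X12 pairs `16 ∤ h(−3pℓ) ⟺ s_p(ℓ) = −1`;
* `j0s8_of_sym_of_law : J0S8Sym → R8Law → J0S8` (kernel-checked, trivial logic).

Numerical status (g24, pure python, `compute/ct36.py`, 279 X12 pairs `p ≤ 131`, `ℓ < 6000`):
`FirstDescentX12` holds in 279/279; `Θ₁` non-degenerate ⟺ `16 ∤ h` in 279/279; `Θ₁(−p,−ℓ) = s_p(ℓ)` in
1379/1379 (pair, solution) instances with `ℓ ∤ z`.  Nothing here is an item, a stub or a skeleton
(W-71/W-79); `J0S8`, `J0S8Sym`, `R8Law`, `FirstDescentX12` are NOT proved here.  BSD is not proved by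
any of this.
-/

set_option linter.dupNamespace false

namespace Summit.BirchSwinnertonDyer.BirchSwinnertonDyer.Cruxes.HeegnerTwistCouplingInSupply.TransferG24

open Literature.NumberTheory.EllipticCurves WeierstrassCurve

/-! ### Verbatim copies of the g20/g23 `Prop`s (`SketchTransferG23.lean`, commit 4308be6e2fd7). -/

/-- The X12 corner parameters: primes `p ≡ 11 (mod 12)`, `ℓ ≡ 23 (mod 24)` with `(ℓ/p) = −1`. -/
def IsX12Pair (p ℓ : ℕ) : Prop :=
  p.Prime ∧ ℓ.Prime ∧ p % 12 = 11 ∧ ℓ % 24 = 23 ∧ jacobiSym (ℓ : ℤ) p = -1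

/-- `36a1 : y² = x³ + 1`; `E36.quadraticTwist M = ⟨0,0,0,0,M³⟩ = y² = x³ + M³`. -/
def E36 : WeierstrassCurve ℚ := ⟨0, 0, 0, 0, 1⟩

/-- **(J0-S8)** (banked EC half, verbatim from g23). -/
def J0S8 : Prop :=
  ∀ (p ℓ : ℕ), IsX12Pair p ℓ →
  ∀ (K : Type) [Field K] [NumberField K], IsImaginaryQuadratic K →
    NumberField.discr K = -(3 * p * ℓ : ℤ) → ¬ 16 ∣ NumberField.classNumber K →
    (E36.quadraticTwist ((p : ℚ) * ℓ)).selmerCorank 2 = 0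

/-! ### g24: first descent, the symbol, and the decomposition of `J0S8` -/

/-- **First `2`-isogeny descent for the X12 corner.**  `E_{pℓ} : y² = x³ + (pℓ)³` is, after `x ↦ X − pℓ`,
the two-torsion normal form `E_{a,b} = ⟨0,a,0,b,0⟩` with `a = −3pℓ`, `b = 3(pℓ)²`, `T = (0,0)`;
`φ : E → E' = E_{6pℓ, −3(pℓ)²}`.  In the tree's currency (`TwoIsogenySelmerGroup.lean`, AEC X.4.9):
`S^{(φ)}(E/ℚ) = twoIsogenySelmerGroup' a b = twoIsogenySelmerGroup (6pℓ) (−3p²ℓ²)` is the full set of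
negative-discriminant-compatible divisors `{1,−3,−p,3p,−ℓ,3ℓ,pℓ,−3pℓ}` (dimension `3`, basis `−3 = δ(T')`,
`−p`, `−ℓ`), and `S^{(φ̂)}(E'/ℚ) = twoIsogenySelmerGroup a b = {1, 3}` (`3 ≡ b = δ(T)`: torsion only).
Local conditions used: `p ≡ ℓ ≡ 2 (mod 3)`, `p ≡ 3 (mod 4)`, `ℓ ≡ 7 (mod 8)`, `(ℓ/p) = −1`.
Verified numerically for 279/279 pairs (g24).  [first-descent literature for `y² = x³ − n³`:
Feng–Xiong 2012, doi:10.1112/S0025579312000046 (acq-14154)] -/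
def FirstDescentX12 : Prop :=
  ∀ (p ℓ : ℕ), IsX12Pair p ℓ →
    twoIsogenySelmerGroup (6 * ((p : ℤ) * ℓ)) (-3 * ((p : ℤ) * ℓ) ^ 2) =
        {1, -3, -(p : ℤ), 3 * (p : ℤ), -(ℓ : ℤ), 3 * (ℓ : ℤ), (p : ℤ) * ℓ, -3 * ((p : ℤ) * ℓ)} ∧
    twoIsogenySelmerGroup (-3 * ((p : ℤ) * ℓ)) (3 * ((p : ℤ) * ℓ) ^ 2) = {1, 3}

/-- Admissible data for the symbol `s_p(ℓ)`: a primitive solution `3x² = py² + z²` with `x > 0`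
(so `α = 3x + y√(3p)` is totally positive and `(α) = 𝔞² · (primes above 3)`), a square root `w` of
`3p` modulo `ℓ` (exists for X12 pairs: `(3p/ℓ) = 1`), and `ℓ ∤ z` (so `α` is an `𝔩`-unit for both
primes `𝔩 ∣ ℓ`). -/
def RedeiData (p ℓ : ℕ) (x y z w : ℤ) : Prop :=
  0 < x ∧ 3 * x ^ 2 = p * y ^ 2 + z ^ 2 ∧ Int.gcd x y = 1 ∧ ¬ (ℓ : ℤ) ∣ z ∧
    (ℓ : ℤ) ∣ w ^ 2 - 3 * p

/-- **`s_p(ℓ) = −1`**: the quadratic symbol `((3x + y·w)/ℓ)` of `α = 3x + y√(3p)` at a split prime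
above `ℓ` is `−1` for some (equivalently, by `RedeiWellDefined`, every) admissible datum.  This is the
Rédei symbol `[3p, 3, −ℓ]` (conic `X² − 3p·Y² − 3·Z² = 0 ⟺ 3x² = py² + z²`), and — the g24 finding —
the value `Θ₁(−p, −ℓ)` of the Cassels–Tate pairing on `S^{(φ)}(E_{pℓ}/ℚ)`. -/
def RedeiMinus (p ℓ : ℕ) : Prop :=
  ∃ x y z w : ℤ, RedeiData p ℓ x y z w ∧ jacobiSym (3 * x + y * w) ℓ = -1

/-- Well-definedness of `s_p(ℓ)` for X12 pairs: two admissible data give the same symbol (two totally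
positive `α` with `(α)` a square ideal away from `3` differ by `c·γ²`, `c ∈ {1,3,p,3p}·ℚ^{×2}`, and
`(3/ℓ) = (p/ℓ) = 1`; `(α/𝔩)(α/𝔩̄) = (3z²/ℓ) = 1`).  Numerically 1379/1379 (g24). -/
def RedeiWellDefined : Prop :=
  ∀ (p ℓ : ℕ), IsX12Pair p ℓ → ∀ (x y z w x' y' z' w' : ℤ),
    RedeiData p ℓ x y z w → RedeiData p ℓ x' y' z' w' →
      jacobiSym (3 * x + y * w) ℓ = jacobiSym (3 * x' + y' * w') ℓ

/-- **(J0-S8) with the symbol hypothesis** — the second-`2`-descent statement proper: for an X12 pair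
with `s_p(ℓ) = −1` the `2^∞`-Selmer corank of `E_{pℓ} = (36a1)^{(pℓ)}` is `0`.  Route of proof
(Cassels 1998 / Fisher arXiv:1509.03234 Thm 2.1, `m = 1`): `Θ₁` alternating on `S₁ = S^{(φ)}(E/ℚ)`
(dim 3, `FirstDescentX12`) with kernel `S₂ ⊇ E'(ℚ)/φE(ℚ) ∋ −3`; the explicit pushout-function formula
`Θ₁(ξ,η) = ∏_v (f(P_v), η)_v` evaluated on the conic `X² − 3Y² = −pZ²` gives `Θ₁(−p,−ℓ) = s_p(ℓ)`;
hence `S₂ = ⟨−3⟩`, `S'₂ = S'₁ = ⟨3⟩`, `rank E(ℚ) ≤ dim S₂ + dim S'₂ − 2 = 0`, `Ш(E')[φ̂] = 0 = Ш₂`,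
so `Ш(E')[2] = 0`, `Ш(E)[2^∞] = Ш(E)[φ] ≅ (ℤ/2)²` (finite), corank `0`.  Sibling (j = 1728):
Ouyang–Zhang, *On second 2-descent and non-congruent numbers*, Acta Arith. 170 (2015); Smith
arXiv:1607.07860 (CT pairing = Rédei symbols / governing fields). -/
def J0S8Sym : Prop :=
  ∀ (p ℓ : ℕ), IsX12Pair p ℓ → RedeiMinus p ℓ → (E36.quadraticTwist ((p : ℚ) * ℓ)).selmerCorank 2 = 0

/-- The same mechanism at the level of the Mordell–Weil rank of the two-torsion normal form
`E_{a,b}`, `(a, b) = (−3pℓ, 3p²ℓ²)` (what the pairing computation certifies pair by pair: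
128/128 g24 pairs with `16 ∤ h` have `rank = 0`, `Ш(E)[2^∞] ≅ (ℤ/2)²`). -/
def J0RankZeroSym : Prop :=
  ∀ (p ℓ : ℕ), IsX12Pair p ℓ → RedeiMinus p ℓ →
    (⟨0, -3 * ((p : ℚ) * ℓ), 0, 3 * ((p : ℚ) * ℓ) ^ 2, 0⟩ : WeierstrassCurve ℚ).mordellWeilRank = 0

/-- **Rédei–Reichardt `8`-rank law for `−3pℓ`** (memo R8-X12 g20, numerically 279/279 in g24): for an
X12 pair the `4`-rank of `Cl(ℚ(√−3pℓ))` is `1` with `d₄`-decomposition `−3pℓ = (3p)·(−ℓ)`, and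
`16 ∣ h(−3pℓ)` iff the Rédei symbol is `+1`, i.e. `16 ∤ h ⟺ s_p(ℓ) = −1`.  [Rédei–Reichardt 1934;
Stevenhagen, *Redei reciprocity, governing fields and negative Pell*, Math. Proc. Camb. 2022, §7] -/
def R8Law : Prop :=
  ∀ (p ℓ : ℕ), IsX12Pair p ℓ →
  ∀ (K : Type) [Field K] [NumberField K], IsImaginaryQuadratic K →
    NumberField.discr K = -(3 * p * ℓ : ℤ) → (¬ 16 ∣ NumberField.classNumber K ↔ RedeiMinus p ℓ)

/-- **Decomposition of the banked EC half**: `J0S8 ⇐ J0S8Sym ∧ R8Law` (only the `→` direction of the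
law is used). -/
theorem j0s8_of_sym_of_law (hS : J0S8Sym) (hR : R8Law) : J0S8 := by
  intro p ℓ hpl K _ _ hK hdisc h16
  exact hS p ℓ hpl ((hR p ℓ hpl K hK hdisc).mp h16)

/-- The supply side may equally be phrased with the symbol: under `R8Law` the class-number condition
of the crux's supply statement and the Frobenian condition `s_p(ℓ) = −1` (a Chebotarev class in the
`D₄`-field `ℚ(√3p, √α_p)^{gal}`, density `1/2` among X12 primes `ℓ`) coincide. -/
theorem supply_iff_of_law (hR : R8Law) {p ℓ : ℕ} (hpl : IsX12Pair p ℓ) (K : Type) [Field K]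
    [NumberField K] (hK : IsImaginaryQuadratic K) (hdisc : NumberField.discr K = -(3 * p * ℓ : ℤ)) :
    ¬ 16 ∣ NumberField.classNumber K ↔ RedeiMinus p ℓ :=
  hR p ℓ hpl K hK hdisc

/-- Sanity instance of `RedeiData`: `p = 11`: `3·2² = 11·1² + 1²`, and for `ℓ = 167`,
`w = 37` has `37² = 1369 ≡ 33 = 3·11 (mod 167)`; symbol `((6 + 37)/167) = (43/167) = −1`, matching
`16 ∤ h(−3·11·167) = 56` and `Θ₁(−11,−167) = −1` (g24 table). -/
theorem redeiData_11_167 : RedeiData 11 167 2 1 1 37 := by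
  refine ⟨by norm_num, by norm_num, by decide, by decide, ?_⟩
  norm_num

theorem redeiMinus_11_167 : RedeiMinus 11 167 :=
  ⟨2, 1, 1, 37, redeiData_11_167, by norm_num⟩

end Summit.BirchSwinnertonDyer.BirchSwinnertonDyer.Cruxes.HeegnerTwistCouplingInSupply.TransferG24
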